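/-
Origin: expansion seat `planner-pub-hodgecm-pv01-0`, handover 2026-08-18T03:45:47Z (`HOME/pub-hodgecm-pv01/lean/Pv01/SatakeMultiset.lean`, md5 4fed5715, 73 lines);
landed by the gen-5 packager in gate run 20 as `HodgeCM/PerL34/SatakeMultiset.lean` (verbatim).
-/
/-
Origin: HOME/pub-hodgecm-pv01/lean/Pv01/SatakeMultiset.lean (module `Pv01.SatakeMultiset`; the packager renames to
`HodgeCM.PerL34.SatakeMultiset`) — session planner-pub-hodgecm-pv01-0 (unit pub-hodgecm-pv01, DAG-NODE PROVER #01).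
DAG node (HOME/LEMMAS.md v2 §1): N02 (PerL v5 §1.4 "Inputs from [Y1neg]", tex ll. 88–113) — SUPPORT #2: the
elementary "multiset argument" of [Y1neg] v2 Lemma 5.2 (conjugation of the type), ll. 169–171, which is link (E3) of
the chain behind (eq:Na) (HOME/GAPS.md entry pv01-G1).  Pure Mathlib.
-/
import Mathlib

set_option autoImplicit false

/-!
# The multiset step of [Y1neg] Lemma 5.2 (link (E3) behind PerL v5 (eq:Na))

[Y1neg] v2 ll. 169–171 (VERBATIM): "By \eqref{eq:sat} for `\pi'` (or `\ol{\pi'}`), the same multiset is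
`\{x'_w,\ y'_w,\ y'_w/q_w\}` with `|x'_w|=1` and `y'_w=\psi(\pi')_w(\varpi_w)` of absolute value `q_w^{1/2}`. The three
elements of the second multiset have the pairwise distinct absolute values `1,q_w^{1/2},q_w^{-1/2}`, and the only
ordered pair of them with ratio `q_w` is `(y'_w,y'_w/q_w)` (the other ordered pairs of distinct elements have ratios of
absolute value `q_w^{\pm1/2}` or `q_w^{-1}`). Since `(\tau y_w,\tau y_w/q_w)` is such a pair, `\tau y_w=y'_w`."

Typed form: `q > 1` real, `x' y' : ℂ` with `‖x'‖ = 1`, `‖y'‖ = √q`; if both `a` (`= τ y_w`) and `a / q` (`= τ(y_w/q_w)`,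
`τ` fixing the rational `q_w`) lie in `{x', y', y'/q}`, then `a = y'`.  Nothing else is assumed; in particular nothing
about `τ` (an abstract automorphism of `ℂ` does not preserve absolute values — the argument only uses membership).
-/

namespace HodgeCM
namespace PerL34
namespace SatakeMultiset

/-- **[Y1neg] L5.2, multiset step.** -/
theorem eq_of_mem_of_div_mem {q : ℝ} (hq : 1 < q) {x' y' a : ℂ} (hx : ‖x'‖ = 1) (hy : ‖y'‖ = Real.sqrt q)
    (ha : a = x' ∨ a = y' ∨ a = y' / q) (hb : a / q = x' ∨ a / q = y' ∨ a / q = y' / q) : a = y' := by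
  have hq0 : (0 : ℝ) < q := by linarith
  have hsq : 1 < Real.sqrt q := by
    rw [show (1 : ℝ) = Real.sqrt 1 by simp]
    exact Real.sqrt_lt_sqrt (by norm_num) hq
  have hsq_lt_q : Real.sqrt q < q := by nlinarith [Real.mul_self_sqrt hq0.le, hsq]
  -- norms of the candidates
  have nq : ∀ b : ℂ, ‖b / (q : ℂ)‖ = ‖b‖ / q := by
    intro b; rw [norm_div]; simp [abs_of_pos hq0]
  have n1 : ‖y' / (q : ℂ)‖ = Real.sqrt q / q := by rw [nq, hy]
  rcases ha with h | h | h
  · -- a = x', ‖a/q‖ = 1/q ∉ {1, √q, √q/q}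
    exfalso
    rw [h] at hb
    have hn : ‖x' / (q : ℂ)‖ = 1 / q := by rw [nq, hx]
    have h1 : 1 / q < 1 := by rw [div_lt_one hq0]; exact hq
    rcases hb with e | e | e
    · have := congrArg (fun z : ℂ => ‖z‖) e; simp only [hn, hx] at this; linarith
    · have := congrArg (fun z : ℂ => ‖z‖) e; simp only [hn, hy] at this; linarith
    · have := congrArg (fun z : ℂ => ‖z‖) e; simp only [hn, n1] at this
      -- 1/q = √q/q ⇒ 1 = √q
      have : (1 : ℝ) = Real.sqrt q := by
        field_simp at this
        linarith
      linarith
  · exact h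
  · -- a = y'/q, ‖a/q‖ = √q/q/q ∉ {1, √q, √q/q}
    exfalso
    rw [h] at hb
    have hn : ‖y' / (q : ℂ) / (q : ℂ)‖ = Real.sqrt q / q / q := by rw [nq, n1]
    have hlt1 : Real.sqrt q / q < 1 := by rw [div_lt_one hq0]; exact hsq_lt_q
    have hpos : 0 < Real.sqrt q / q := div_pos (by linarith) hq0
    have hlt2 : Real.sqrt q / q / q < Real.sqrt q / q := by
      rw [div_lt_iff₀ hq0]; nlinarith
    rcases hb with e | e | e
    · have := congrArg (fun z : ℂ => ‖z‖) e; simp only [hn, hx] at this; linarith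
    · have := congrArg (fun z : ℂ => ‖z‖) e; simp only [hn, hy] at this; linarith
    · have := congrArg (fun z : ℂ => ‖z‖) e; simp only [hn, n1] at this; linarith

end SatakeMultiset
end PerL34
end HodgeCM
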